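import Literature.NumberTheory.EllipticCurves.ZpExtensionGaloisTwistPrimary
import Literature.NumberTheory.GaloisRepresentations.AbsGaloisGroupCompact
import HarnessLib

/-!
# The unit twist `A(χ_u)` at infinite level — proofs

Complements to `ZpExtensionGaloisTwistPrimary` (the type synonym `κ.UnitTwist M hM u hu` = Greenberg's
`A_s = A ⊗ κ^s`, LNM 1716 §4 p. 105, for `κ^s` replaced by `χ_u = u^κ`):

* `UnitTwist.continuous_smul` — the twisted orbit maps are continuous;
* `subgroupH1Congr_conjH1_eq_zsmul_const` — generic: if `σ` acts on `T` as `c · σ` acts on `M` then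
  `e_* ∘ conj_σ = c · conj_σ ∘ e_*` on `H¹(H, ·)`;
* the specialisations to `H ≤ ker κ` (global, `H ≤ Γ_K`) and to `H ≤ D ≤ Γ_K` (decomposition groups):
  `UnitTwist.equivariant_ofTwist(_subgroup)`, `UnitTwist.subgroupH1Congr_conjH1_of_le_kerSubgroup`,
  `…_of_isTopGenerator` (`e_* conj_γ = u · conj_γ e_*`: `conj_γ − 1` on `H¹(K_∞, A(χ_u))` is
  `ψ_u = u·conj_γ − 1` on `H¹(K_∞, A)`), `…_subgroup`.

References: R. Greenberg, LNM 1716 (1999), §4 pp. 105–107 [GreenbergLNM1716]; J.-P. Serre, *Galois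
Cohomology* (1997), I §2.1, §2.4 [SerreGaloisCohomology1997].
-/

noncomputable section

open Field Topology

universe u

/-! ## §6. Proofs: continuity of the twisted orbit maps; `conj` formulas for `H ≤ ker κ` -/

namespace Literature.NumberTheory.EllipticCurves

open Literature.NumberTheory.GaloisRepresentations

section H1TransportConst

variable {G : Type u} [Group G] [TopologicalSpace G] [IsTopologicalGroup G]
variable {M T : Type u} [AddCommGroup M] [DistribMulAction G M] [TopologicalSpace M]
  [DiscreteTopology M] [AddCommGroup T] [DistribMulAction G T] [TopologicalSpace T]
  [DiscreteTopology T]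

/-- **How `conj_σ` transforms, constant-scalar case**: if `e (σ t) = c · σ (e t)` for ALL `t` (e.g. `σ = γ`
a topological generator acting on `A(χ_u)` by `u · γ`), then `e_* (conj_σ x) = c · conj_σ (e_* x)` for every
class `x ∈ H¹(H, T)` — no compactness or torsion hypothesis. Greenberg: on `H¹(F_∞, A_s) = H¹(F_∞, A)`
«the action of `Γ` changes in a simple way». [cite: GreenbergLNM1716, §4 p. 107] -/
theorem subgroupH1Congr_conjH1_eq_zsmul_const (H : Subgroup G) [H.Normal] (e : T ≃+ M)
    (he : ∀ (x : H) (t : T), (e : T →+ M) (ContinuousMonoidHom.id H x • t) = x • (e : T →+ M) t)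
    (σ : G) (c : ℤ) (hσ : ∀ t : T, e (σ • t) = c • (σ • e t)) (x : subgroupH1 H T) :
    subgroupH1Congr H e he (conjH1 H T σ x) = c • conjH1 H M σ (subgroupH1Congr H e he x) := by
  obtain ⟨ξ, rfl⟩ := oneCocycleClass_surjective _ x
  have key : contOneCocycles.push (e : T →+ M) he (conjCocycle H σ ξ) =
      c • conjCocycle H σ (contOneCocycles.push (e : T →+ M) he ξ) := by
    apply Subtype.ext; ext n
    change (e : T →+ M) ((conjCocycle H σ ξ).1 n) =
      c • (conjCocycle H σ (contOneCocycles.push (e : T →+ M) he ξ)).1 n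
    rw [conjCocycle_apply, conjCocycle_apply, contOneCocycles.push_apply, AddMonoidHom.coe_coe, hσ]
  have hs : oneCocycleClass (discreteTopRep H M)
      (c • conjCocycle H σ (contOneCocycles.push (e : T →+ M) he ξ)) =
      c • oneCocycleClass _ (conjCocycle H σ (contOneCocycles.push (e : T →+ M) he ξ)) :=
    map_zsmul (oneCocycleClassₗ (discreteTopRep H M)) c _
  rw [conjH1_oneCocycleClass, subgroupH1Congr_oneCocycleClass, subgroupH1Congr_oneCocycleClass, key,
    hs, conjH1_oneCocycleClass]

end H1TransportConst

namespace ZpExtension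

namespace UnitTwist

variable {K : Type u} [Field K] {p : ℕ} [Fact p.Prime] {κ : ZpExtension K p}
variable {M : Type u} [AddCommGroup M] [DistribMulAction (absoluteGaloisGroup K) M]
  {hM : IsPrimaryTorsion p M} {u : ℤ} {hu : (p : ℤ) ∣ u - 1}

/-- The orbit maps `σ ↦ σ ⋆ a` of `A(χ_u)` are continuous (open stabilisers, discrete target).
[cite: SerreGaloisCohomology1997, I §2.1] -/
theorem continuous_smul (hMo : ∀ m : M, IsOpen {σ : absoluteGaloisGroup K | σ • m = m})
    (t : κ.UnitTwist M hM u hu) : Continuous fun σ : absoluteGaloisGroup K ↦ σ • t := by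
  refine continuous_discrete_rng.2 fun b ↦ ?_
  by_cases hb : ∃ σ₀ : absoluteGaloisGroup K, σ₀ • t = b
  · obtain ⟨σ₀, rfl⟩ := hb
    have e : (fun σ : absoluteGaloisGroup K ↦ σ • t) ⁻¹' {σ₀ • t} =
        (fun σ ↦ σ₀⁻¹ * σ) ⁻¹' {σ : absoluteGaloisGroup K | σ • t = t} := by
      ext σ
      simp only [Set.mem_preimage, Set.mem_singleton_iff, Set.mem_setOf_eq]
      constructor
      · intro h; rw [mul_smul, h, ← mul_smul, inv_mul_cancel, one_smul]
      · intro h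
        have h' := congrArg (fun x ↦ σ₀ • x) h
        simp only [← mul_smul, mul_inv_cancel_left] at h'
        exact h'
    rw [e]
    exact (isOpen_stabilizer hMo t).preimage (continuous_const.mul continuous_id)
  · have e : (fun σ : absoluteGaloisGroup K ↦ σ • t) ⁻¹' {b} = ∅ := by
      ext σ
      simp only [Set.mem_preimage, Set.mem_singleton_iff, Set.mem_empty_iff_false, iff_false]
      exact fun h ↦ hb ⟨σ, h⟩
    rw [e]; exact isOpen_empty

section Global

variable [TopologicalSpace M] [DiscreteTopology M]

omit [TopologicalSpace M] [DiscreteTopology M] in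
/-- **On a subgroup `H ≤ ker κ` the identity `A(χ_u) → A` is `H`-equivariant** (the compatible pair
`(id_H, ofTwist)` of `subgroupH1Congr`). [cite: GreenbergLNM1716, §4 p. 107] -/
theorem equivariant_ofTwist {H : Subgroup (absoluteGaloisGroup K)} (hH : H ≤ κ.kerSubgroup) (x : H)
    (t : κ.UnitTwist M hM u hu) :
    ((ofTwist : κ.UnitTwist M hM u hu ≃+ M) : κ.UnitTwist M hM u hu →+ M)
        (ContinuousMonoidHom.id H x • t) =
      x • ((ofTwist : κ.UnitTwist M hM u hu ≃+ M) : κ.UnitTwist M hM u hu →+ M) t := by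
  change ofTwist ((x : absoluteGaloisGroup K) • t) = (x : absoluteGaloisGroup K) • ofTwist t
  exact ofTwist_smul_of_mem_kerSubgroup (hH x.2) t

/-- **`H¹(H, A(χ_u)) ≃ H¹(H, A)` twists `conj_σ` by `u^{κ(σ)}`** for a closed normal `H ≤ ker κ`: for every
class `x` killed by `p^k`, `e_*(conj_σ x) = u^{κ σ mod p^k} · conj_σ (e_* x)` (Greenberg: `H¹(F_∞, A_s) =
H¹(F_∞, A) ⊗ κ^s`). [cite: GreenbergLNM1716, §4 p. 107] -/
theorem subgroupH1Congr_conjH1_of_le_kerSubgroup {H : Subgroup (absoluteGaloisGroup K)} [H.Normal]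
    (hH : H ≤ κ.kerSubgroup) (hHc : IsClosed (H : Set (absoluteGaloisGroup K)))
    (σ : absoluteGaloisGroup K) (x : subgroupH1 H (κ.UnitTwist M hM u hu)) {k : ℕ} (hk : p ^ k • x = 0) :
    subgroupH1Congr H ofTwist (equivariant_ofTwist hH) (conjH1 H (κ.UnitTwist M hM u hu) σ x) =
      (u ^ κ.twistExponent k σ) • conjH1 H M σ (subgroupH1Congr H ofTwist (equivariant_ofTwist hH) x) := by
  haveI : CompactSpace (absoluteGaloisGroup K) := absoluteGaloisGroup_compactSpace K
  haveI : CompactSpace H := isCompact_iff_compactSpace.mp hHc.isCompact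
  exact subgroupH1Congr_conjH1_eq_zsmul H ofTwist (equivariant_ofTwist hH) isPrimaryTorsion σ
    (fun k ↦ u ^ κ.twistExponent k σ) (fun _ _ ht ↦ ofTwist_smul_of_nsmul_eq_zero σ ht)
    (fun _ _ _ hy hy' ↦ κ.pow_twistExponent_zsmul_eq hu hy hy' σ) x hk

/-- **For a topological generator `γ`: `e_*(conj_γ x) = u · conj_γ (e_* x)`** on `H¹(H, A(χ_u)) ≃ H¹(H, A)`,
`H ≤ ker κ` normal — so `conj_γ − 1` on `H¹(K_∞, A(χ_u))` is `ψ_u = u·conj_γ − 1` on `H¹(K_∞, A)`.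
[cite: GreenbergLNM1716, §4 p. 107] -/
theorem subgroupH1Congr_conjH1_of_isTopGenerator {H : Subgroup (absoluteGaloisGroup K)} [H.Normal]
    (hH : H ≤ κ.kerSubgroup) {γ : absoluteGaloisGroup K} (hγ : κ.IsTopGenerator γ)
    (x : subgroupH1 H (κ.UnitTwist M hM u hu)) :
    subgroupH1Congr H ofTwist (equivariant_ofTwist hH) (conjH1 H (κ.UnitTwist M hM u hu) γ x) =
      u • conjH1 H M γ (subgroupH1Congr H ofTwist (equivariant_ofTwist hH) x) :=
  subgroupH1Congr_conjH1_eq_zsmul_const H ofTwist (equivariant_ofTwist hH) γ u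
    (fun t ↦ ofTwist_smul_of_isTopGenerator hγ t) x

/-- The inverse direction: `e_*⁻¹ (u · conj_γ y) = conj_γ (e_*⁻¹ y)`. [cite: GreenbergLNM1716, §4 p. 107] -/
theorem subgroupH1Congr_symm_zsmul_conjH1_of_isTopGenerator {H : Subgroup (absoluteGaloisGroup K)}
    [H.Normal] (hH : H ≤ κ.kerSubgroup) {γ : absoluteGaloisGroup K} (hγ : κ.IsTopGenerator γ)
    (y : subgroupH1 H M) :
    (subgroupH1Congr H ofTwist (equivariant_ofTwist (hM := hM) (u := u) (hu := hu) hH)).symm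
        (u • conjH1 H M γ y) =
      conjH1 H (κ.UnitTwist M hM u hu) γ
        ((subgroupH1Congr H ofTwist (equivariant_ofTwist (hM := hM) (u := u) (hu := hu) hH)).symm y) := by
  apply (subgroupH1Congr H ofTwist (equivariant_ofTwist (hM := hM) (u := u) (hu := hu) hH)).injective
  rw [AddEquiv.apply_symm_apply, subgroupH1Congr_conjH1_of_isTopGenerator hH hγ, AddEquiv.apply_symm_apply]

end Global

section Local

variable [TopologicalSpace M] [DiscreteTopology M]

omit [TopologicalSpace M] [DiscreteTopology M] in
/-- **Local version** (decomposition groups): for `D ≤ Γ_K` and `H ≤ D` mapping into `ker κ` (e.g.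
`H = ker(κ|_D)`), the identity `A(χ_u) → A` is `H`-equivariant for the restricted actions.
[cite: GreenbergLNM1716, §4 p. 107] -/
theorem equivariant_ofTwist_subgroup {D : Subgroup (absoluteGaloisGroup K)} {H : Subgroup D}
    (hH : ∀ x : H, ((x : D) : absoluteGaloisGroup K) ∈ κ.kerSubgroup) (x : H)
    (t : κ.UnitTwist M hM u hu) :
    ((ofTwist : κ.UnitTwist M hM u hu ≃+ M) : κ.UnitTwist M hM u hu →+ M)
        (ContinuousMonoidHom.id H x • t) =
      x • ((ofTwist : κ.UnitTwist M hM u hu ≃+ M) : κ.UnitTwist M hM u hu →+ M) t := by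
  change ofTwist (((x : D) : absoluteGaloisGroup K) • t) = ((x : D) : absoluteGaloisGroup K) • ofTwist t
  exact ofTwist_smul_of_mem_kerSubgroup (hH x) t

/-- **Local `conj` formula**: on `H¹(H, A(χ_u)) ≃ H¹(H, A)` for `H ≤ D ≤ Γ_K` compact normal in `D` and
mapping into `ker κ`, `e_*(conj_d x) = u^{κ d mod p^k} · conj_d (e_* x)` for `x` killed by `p^k`
(the twisted `D_v`-action on `H¹(K_{∞,w}, A_s)`). [cite: GreenbergLNM1716, §4 p. 107] -/
theorem subgroupH1Congr_conjH1_subgroup {D : Subgroup (absoluteGaloisGroup K)} {H : Subgroup D} [H.Normal]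
    [CompactSpace H] (hH : ∀ x : H, ((x : D) : absoluteGaloisGroup K) ∈ κ.kerSubgroup) (d : D)
    (x : subgroupH1 H (κ.UnitTwist M hM u hu)) {k : ℕ} (hk : p ^ k • x = 0) :
    subgroupH1Congr H ofTwist (equivariant_ofTwist_subgroup hH) (conjH1 H (κ.UnitTwist M hM u hu) d x) =
      (u ^ κ.twistExponent k (d : absoluteGaloisGroup K)) •
        conjH1 H M d (subgroupH1Congr H ofTwist (equivariant_ofTwist_subgroup hH) x) :=
  subgroupH1Congr_conjH1_eq_zsmul H ofTwist (equivariant_ofTwist_subgroup hH) isPrimaryTorsion d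
    (fun k ↦ u ^ κ.twistExponent k (d : absoluteGaloisGroup K))
    (fun _ _ ht ↦ ofTwist_smul_of_nsmul_eq_zero (d : absoluteGaloisGroup K) ht)
    (fun _ _ _ hy hy' ↦ κ.pow_twistExponent_zsmul_eq hu hy hy' (d : absoluteGaloisGroup K)) x hk

end Local

end UnitTwist

end ZpExtension

end Literature.NumberTheory.EllipticCurves

end
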